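import Mathlib
import Summits.Ventures.PercRepro2.Defs
import Summits.Ventures.PercRepro2.Independence
import Summits.Ventures.PercRepro2.Harris
import Summits.Ventures.PercRepro2.Graph
import Summits.Ventures.PercRepro2.Exploration
import Summits.Ventures.PercRepro2.PartDefs

/-!
# The core-free union theorem (PART), part 2: the factorisation of one partition (blind cell
PercRepro2, typer-1; mine-1 g9 `proofs/MINE1-IID-UNION.md` §2, the display
`P(C = W₁)P(C′ = W₂) = Π_{e ∈ E(l,·)} (1−p_e) · Σ_{(ω₁,ω₂)} P_p(η) · Π_{e ∈ E(S,V∖S)} (1−p_e)`)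

For `τ l = false`, with `W₁ = sideSet l τ true = S ∪ {l}` and `W₂ = sideSet l τ false = V ∖ S`:

**`prob_clusterEvent_mul_eq`**
`P(C = W₁) · P(C = W₂) = Π_{root edges} (1 − p_e) · Π_{cross edges} (1 − p_e) · P(η spans ∧ cross edges closed)`.

Proof: the exploration identity `P(C = W) = P(W internally connected) · Π_{∂W} (1 − p_e)`
(`prob_clusterEvent_eq_mul_prod`); the two internal-connection events are independent (their
non-loop inside edges are disjoint, `disjoint_within_sides`) and independent of the cross edges
(`disjoint_within_sides_cross`), and `{W₁ int. conn.} ∩ {W₂ int. conn.} ∩ {cross closed} =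
{spans} ∩ {cross closed}` (`internallyConnected_inter_eq`); finally the two boundary products
regroup edge by edge as `root · cross²` (`boundary_factor_mul`).
-/

namespace Summit.Ventures.PercRepro2

namespace Part

open scoped Classical

variable {V : Type*} {E : Type*} [Fintype E] [DecidableEq E] {R : Type*} [CommRing R]

/-! ## Boundary membership -/

section Boundary

variable {ends : E → Sym2 V}

omit [Fintype E] [DecidableEq E] in
/-- An edge `{u, v}` is on the boundary of `S` iff exactly one end lies in `S`. -/
lemma mem_boundary_iff {S : Set V} {e : E} {u v : V} (hends : ends e = s(u, v)) :
    e ∈ boundary ends S ↔ (u ∈ S ∧ v ∉ S) ∨ (v ∈ S ∧ u ∉ S) := by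
  constructor
  · rintro ⟨x, hx, y, hy, hxy⟩
    rw [hends, Sym2.eq_iff] at hxy
    rcases hxy with ⟨rfl, rfl⟩ | ⟨rfl, rfl⟩
    · exact Or.inl ⟨hx, hy⟩
    · exact Or.inr ⟨hx, hy⟩
  · rintro (⟨hu, hv⟩ | ⟨hv, hu⟩)
    · exact ⟨u, hu, v, hv, hends⟩
    · exact ⟨v, hv, u, hu, by rw [hends, Sym2.eq_swap]⟩

omit [Fintype E] [DecidableEq E] in
/-- A root edge at `{u, v}`: one end is `l`, the other is not. -/
lemma rootEdge_iff {l : V} {e : E} {u v : V} (hends : ends e = s(u, v)) :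
    rootEdge ends l e ↔ (u = l ∧ v ≠ l) ∨ (v = l ∧ u ≠ l) := by
  constructor
  · rintro ⟨w, hw, hlw⟩
    rw [hends, Sym2.eq_iff] at hlw
    rcases hlw with ⟨rfl, rfl⟩ | ⟨rfl, rfl⟩
    · exact Or.inl ⟨rfl, hw⟩
    · exact Or.inr ⟨rfl, hw⟩
  · rintro (⟨rfl, hv⟩ | ⟨rfl, hu⟩)
    · exact ⟨v, hv, hends⟩
    · exact ⟨u, hu, by rw [hends, Sym2.eq_swap]⟩

omit [Fintype E] [DecidableEq E] in
/-- **The boundary products regroup edge by edge**: for `τ l = false`,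
`[e ∈ ∂W₁] · [e ∈ ∂W₂] = [root edge] · [cross edge]²` (as factors `1 − p e` or `1`). -/
lemma boundary_factor_mul (p : E → R) {l : V} {τ : V → Bool} (hl : τ l = false) (e : E) :
    (if e ∈ boundary ends (sideSet l τ true) then 1 - p e else 1) *
        (if e ∈ boundary ends (sideSet l τ false) then 1 - p e else 1) =
      (if rootEdge ends l e then 1 - p e else 1) *
        ((if crossEdge ends l τ e then 1 - p e else 1) *
          (if crossEdge ends l τ e then 1 - p e else 1)) := by
  rcases Sym2.mk_surjective (ends e) with ⟨⟨u, v⟩, huv⟩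
  have hends : ends e = s(u, v) := huv.symm
  rw [mem_boundary_iff hends, mem_boundary_iff hends, rootEdge_iff hends, crossEdge_comm hends]
  by_cases hu : u = l <;> by_cases hv : v = l
  · -- a loop at `l`
    subst hu; subst hv
    simp [mem_sideSet]
  · -- a root edge `{l, v}`
    subst hu
    cases hτ : τ v <;> simp [mem_sideSet, hl, hv, hτ]
  · -- a root edge `{u, l}`
    subst hv
    cases hτ : τ u <;> simp [mem_sideSet, hl, hu, hτ]
  · -- both ends away from `l`
    cases hτu : τ u <;> cases hτv : τ v <;> simp [mem_sideSet, hu, hv, hτu, hτv]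

end Boundary

/-! ## The factorisation -/

section Factor

variable (p : E → R) (ends : E → Sym2 V) (l : V)

omit [DecidableEq E] in
/-- `crossClosed` is the all-closed event of the cross edges. -/
lemma crossClosed_eq_allClosed (τ : V → Bool) :
    crossClosed ends l τ = allClosed (Finset.univ.filter fun e => crossEdge ends l τ e) := by
  ext η
  simp [crossClosed, allClosed]

/-- `P(cross edges closed) = Π_{cross} (1 − p e)`. -/
lemma prob_crossClosed (τ : V → Bool) :
    prob p (crossClosed ends l τ) = ∏ e, if crossEdge ends l τ e then 1 - p e else 1 := by
  rw [crossClosed_eq_allClosed, prob_allClosed, Finset.prod_filter]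

/-- The boundary product of a side as a product over all edges. -/
lemma prob_clusterEvent_side_eq (τ : V → Bool) (b : Bool) :
    prob p (clusterEvent ends l (sideSet l τ b)) =
      prob p (internallyConnected ends l (sideSet l τ b)) *
        ∏ e, if e ∈ boundary ends (sideSet l τ b) then 1 - p e else 1 := by
  rw [prob_clusterEvent_eq_mul_prod p ends l (sideSet l τ b)
    (Finset.univ.filter fun e => e ∈ boundary ends (sideSet l τ b)) (by simp),
    Finset.prod_filter]

/-- **The factorisation of one partition** (`τ l = false`):
`P(C = W₁) · P(C = W₂) = Π_{root} (1 − p) · Π_{cross} (1 − p) · P(spans ∧ cross closed)`. -/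
theorem prob_clusterEvent_mul_eq {τ : V → Bool} (hl : τ l = false) :
    prob p (clusterEvent ends l (sideSet l τ true)) *
        prob p (clusterEvent ends l (sideSet l τ false)) =
      (∏ e, if rootEdge ends l e then 1 - p e else 1) *
        (∏ e, if crossEdge ends l τ e then 1 - p e else 1) *
          prob p (spanning ends l ∩ crossClosed ends l τ) := by
  rw [prob_clusterEvent_side_eq, prob_clusterEvent_side_eq]
  -- the two internal-connection events are independent
  have h12 : prob p (internallyConnected ends l (sideSet l τ true)) *
      prob p (internallyConnected ends l (sideSet l τ false)) =
      prob p (internallyConnected ends l (sideSet l τ true) ∩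
        internallyConnected ends l (sideSet l τ false)) :=
    (prob_inter_eq_mul_of_dependsOn p (disjoint_within_sides τ)
      (dependsOn_internallyConnected_nonloop ends l _)
      (dependsOn_internallyConnected_nonloop ends l _)).symm
  -- and independent of the cross edges
  have h3 : prob p (internallyConnected ends l (sideSet l τ true) ∩
      internallyConnected ends l (sideSet l τ false)) *
      (∏ e, if crossEdge ends l τ e then 1 - p e else 1) =
      prob p (spanning ends l ∩ crossClosed ends l τ) := by
    rw [← prob_crossClosed, ← internallyConnected_inter_eq hl]
    exact (prob_inter_eq_mul_of_dependsOn p (disjoint_within_sides_cross τ)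
      (dependsOn_inter (dependsOn_internallyConnected_nonloop ends l _)
        (dependsOn_internallyConnected_nonloop ends l _)) (dependsOn_crossClosed τ)).symm
  -- the boundary products
  have h4 : (∏ e, if e ∈ boundary ends (sideSet l τ true) then 1 - p e else 1) *
      (∏ e, if e ∈ boundary ends (sideSet l τ false) then 1 - p e else 1) =
      (∏ e, if rootEdge ends l e then 1 - p e else 1) *
        ((∏ e, if crossEdge ends l τ e then 1 - p e else 1) *
          (∏ e, if crossEdge ends l τ e then 1 - p e else 1)) := by
    rw [← Finset.prod_mul_distrib, ← Finset.prod_mul_distrib, ← Finset.prod_mul_distrib]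
    exact Finset.prod_congr rfl fun e _ => boundary_factor_mul p hl e
  calc prob p (internallyConnected ends l (sideSet l τ true)) *
        (∏ e, if e ∈ boundary ends (sideSet l τ true) then 1 - p e else 1) *
      (prob p (internallyConnected ends l (sideSet l τ false)) *
        ∏ e, if e ∈ boundary ends (sideSet l τ false) then 1 - p e else 1) =
      (prob p (internallyConnected ends l (sideSet l τ true)) *
        prob p (internallyConnected ends l (sideSet l τ false))) *
      ((∏ e, if e ∈ boundary ends (sideSet l τ true) then 1 - p e else 1) *
        (∏ e, if e ∈ boundary ends (sideSet l τ false) then 1 - p e else 1)) := by ring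
    _ = prob p (internallyConnected ends l (sideSet l τ true) ∩
          internallyConnected ends l (sideSet l τ false)) *
        ((∏ e, if rootEdge ends l e then 1 - p e else 1) *
          ((∏ e, if crossEdge ends l τ e then 1 - p e else 1) *
            (∏ e, if crossEdge ends l τ e then 1 - p e else 1))) := by rw [h12, h4]
    _ = (∏ e, if rootEdge ends l e then 1 - p e else 1) *
        (∏ e, if crossEdge ends l τ e then 1 - p e else 1) *
        (prob p (internallyConnected ends l (sideSet l τ true) ∩
          internallyConnected ends l (sideSet l τ false)) *
          (∏ e, if crossEdge ends l τ e then 1 - p e else 1)) := by ring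
    _ = _ := by rw [h3]

end Factor

end Part

end Summit.Ventures.PercRepro2
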